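import Summits.QuantumFields.YangMills.Theorems.UnitScaleTiltHalvingP1FlatCoreSupplierInduction
import Literature.MathematicalPhysics.QuantumFieldTheory.Balaban1983to89.B9SupplySockB9P3ZdGamma
import HarnessLib

/-!
# Route `UnitScaleTilt`, crux K1 child «MinimiserStabilityRegPr» (stmt-QuantumFields-19200), registered stub `stub_halvingStep` (v10 `BirthV10`) —
# ROAD γ (★★OWNER RULING g28-№11; LEAD-H WORDS 21–24), FILE (γ-3j): ★ THREE JOINS THE γ COMPOSERS READ BY NAME —
# (a) print's split class `cubeLamBP′` from the inner class `cubeLamB` plus the STICKING-OUT bonds, (b) [3]'s windows at `α₀` from the γ windows at `(L²α₀, L·α₂)`,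
# (c) Theorem 4's (1.66)₀ row `h66` on the sides touching `□₀` from J3's fine row on `□̃`

Cell `ym3-torus` (HUMAN RULING D-0037: YM₃ on T³ is ladder rung R3 — NOT d = 4, NOT a mass gap, NOT the Clay problem), width seat `ym-ust-19200-w7` gen 6.
`--supports stmt-QuantumFields-19200 --as helper`; THEOREMS ONLY (0 `def`, 0 `sorry`); count-neutral; nothing here claims a displayed socket, the stub, the crux or the gap.

WHY.  The γ size-row supplier ✓p679581 `HalvingHSiteSizeRowsOfTopRowsGamma.siteSizeRows_of_topRows_γ` (T4γ) reads (i) its `H42` socket on print's split class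
`Λb := cubeLamBP′ L a M′ ρ′ k` (lit ✓`B9SupplySockB9P3ZdGamma.cubeLamBP'`: at level `0` the inner class `cubeLamB … 0`, at the levels `j ≥ 1` print's class
`cubeLamBP … j` = inner bonds AND the bonds sticking out of `□_j^{(j)}` into `B(Λ_{j−1})`), whereas the composers' inner supplier ✓`HalvingHSiteTopH42OfRows.H42_of_rows`
concludes on `cubeLamB … j` (box law «box ⊂ □_j»): §1 `forall_cubeLamBP'_of_cubeLamB_of_cross` joins the inner conclusion with a RESIDUAL clause on the sticking-out
bonds `c ∈ cubeLamBP′ … j ∖ cubeLamB … j`, `1 ≤ j` (ym-ust-20520-w3 g8's LOCATE V7-8γ cfd2f0c2: at the top level these are exactly the crossing bonds of `□^{(k)}`, print's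
(1.29)@(k−1) mechanism; displayed by the composers v3 as ONE residual socket until the mixed-end supplier (M2) lands); (ii) [3] Prop. 4's five windows in the γ shape
(at `L²α₀`, `L·α₂`) while ✓`H42_of_rows` reads the plain shape (at `α₀`, `α₂`) — §2 derives plain from γ (`L ≥ 1`, monotonicity); (iii) the (1.66)₀ row
`h66 : ‖U′(b) − 1‖ ≤ aβ` on the sides touching `□₀` — §3 reads it off J3's fine row on the tilde-cube `□̃ = [tlo (tLo a ρ) k, thi (tHi a M ρ) k]` (every side touching `□₀`
lies in `□̃`: lit ✓`B8Eq131Cubes.collar_cube` + ✓`HalvingP1FlatCoreSupplierInduction.ends_of_sideTouches`).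

References: T. Bałaban, CMP **99** (1985) 75–102 [Balaban1985RegularSpaces] ((1.31) p.82, (1.42) p.83, (1.66) p.87, (1.131) p.99, p.98); CMP **96** (1984) 223–250
[Balaban1984PropagatorsII] ((2.3) p.224); CMP **98** (1985) 17–51 [Balaban1985Averaging] ((97)–(100) p.32).
-/

set_option autoImplicit false

noncomputable section

open NormedSpace

namespace Summit.QuantumFields.YangMills.Theorems.HalvingHGammaComposerJoins

open Literature.MathematicalPhysics.QuantumFieldTheory.Balaban1983to89
open B7Prop1Explicit (e Site)
open B7Prop2Explicit (C0 c2')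
open B7Prop3Flat (c3)
open B8Ineq130 (tlo thi)
open B8Eq131Cubes (cube tLo tHi collar_cube)
open B8Eq131CubesAdmissible (cubeFam cubeFam_false_of_le)
open B8CubeMemberZd (cubeLamB)
open B8Eq140Level (SideTouches)
open B9SupplySockB9P3ZdGamma (cubeLamBP' cubeLamBP'_zero)
open HalvingP1FlatCoreSupplierInduction (ends_of_sideTouches)

variable {d : ℕ}

/-! ## §1 The split class from the inner class and the sticking-out bonds -/

/-- ★ **A LEVELWISE PREDICATE ON PRINT's SPLIT CLASS `cubeLamBP′` FROM THE INNER CLASS `cubeLamB` PLUS THE STICKING-OUT BONDS**: level `0` of the split class IS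
`cubeLamB … 0` (lit ✓`cubeLamBP'_zero`); at a level `j ≥ 1` a bond of `cubeLamBP′ … j` is either in `cubeLamB … j` or a residual (sticking-out) bond.
[cite: Balaban1984PropagatorsII, (2.3) p.224; Balaban1985RegularSpaces, (1.31) p.82, (1.42) p.83] (bookkeeping) -/
theorem forall_cubeLamBP'_of_cubeLamB_of_cross {L : ℕ} {a : Site d} {M ρ k m : ℕ} {P : ℕ → Site d × Fin d → Prop}
    (hB : ∀ j, j ≤ m → ∀ c ∈ cubeLamB L a M ρ k m j, P j c)
    (hX : ∀ j, 1 ≤ j → j ≤ m → ∀ c ∈ cubeLamBP' L a M ρ k m j, c ∉ cubeLamB L a M ρ k m j → P j c) :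
    ∀ j, j ≤ m → ∀ c ∈ cubeLamBP' L a M ρ k m j, P j c := by
  intro j hj c hc
  rcases Nat.eq_zero_or_pos j with rfl | hj1
  · rw [cubeLamBP'_zero] at hc
    exact hB 0 hj c hc
  · by_cases hcB : c ∈ cubeLamB L a M ρ k m j
    · exact hB j hj c hcB
    · exact hX j hj1 hj c hc hcB

/-! ## §2 [3] Prop. 4's windows at `α₀` from the γ windows at `(L²α₀, L·α₂)` -/

/-- `C0·α₀ ≤ ⅓` from `C0·(L²α₀) ≤ ⅓` (`L ≥ 1`, `α₀ ≥ 0`). [cite: Balaban1985Averaging, (97) p.32] (arithmetic) -/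
theorem hα3_of_γ {L : ℕ} (hL : 1 ≤ L) {α₀ : ℝ} (hα₀ : 0 ≤ α₀) (h : C0 d * ((L : ℝ) ^ 2 * α₀) ≤ 1 / 3) : C0 d * α₀ ≤ 1 / 3 := by
  have hLr : (1 : ℝ) ≤ L := by exact_mod_cast hL
  have h1 : α₀ ≤ (L : ℝ) ^ 2 * α₀ := le_mul_of_one_le_left hα₀ (one_le_pow₀ hLr)
  exact (mul_le_mul_of_nonneg_left h1 (B7Prop2Explicit.C0_pos d).le).trans h

/-- `4α₀ ≤ c₂′` from `4(L²α₀) ≤ c₂′` (`L ≥ 1`, `α₀ ≥ 0`). [cite: Balaban1985Averaging, (98) p.32] (arithmetic) -/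
theorem hα4_of_γ {L : ℕ} (hL : 1 ≤ L) {α₀ : ℝ} (hα₀ : 0 ≤ α₀) (h : 4 * ((L : ℝ) ^ 2 * α₀) ≤ c2' d L) : 4 * α₀ ≤ c2' d L := by
  have hLr : (1 : ℝ) ≤ L := by exact_mod_cast hL
  have h1 : α₀ ≤ (L : ℝ) ^ 2 * α₀ := le_mul_of_one_le_left hα₀ (one_le_pow₀ hLr)
  linarith

/-- `e^{cα₀}(1 + Dα₂) ≤ 2` from `e^{c(L²α₀)}(1 + D(Lα₂)) ≤ 2` (`L ≥ 1`; `α₀, α₂, c, D ≥ 0`). [cite: Balaban1985Averaging, (99)-(100) p.32] (arithmetic) -/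
theorem hsmallP_of_γ {L : ℕ} (hL : 1 ≤ L) {α₀ α₂ : ℝ} (c D : ℝ) (hα₀ : 0 ≤ α₀) (hα₂ : 0 ≤ α₂) (hc : 0 ≤ c) (hD : 0 ≤ D)
    (h : Real.exp (c * ((L : ℝ) ^ 2 * α₀)) * (1 + D * ((L : ℝ) * α₂)) ≤ 2) : Real.exp (c * α₀) * (1 + D * α₂) ≤ 2 := by
  have hLr : (1 : ℝ) ≤ L := by exact_mod_cast hL
  have h1 : α₀ ≤ (L : ℝ) ^ 2 * α₀ := le_mul_of_one_le_left hα₀ (one_le_pow₀ hLr)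
  have h2 : α₂ ≤ (L : ℝ) * α₂ := le_mul_of_one_le_left hα₂ hLr
  have h3 : D * α₂ ≤ D * ((L : ℝ) * α₂) := mul_le_mul_of_nonneg_left h2 hD
  have h4 : 0 ≤ 1 + D * α₂ := by positivity
  calc Real.exp (c * α₀) * (1 + D * α₂) ≤ Real.exp (c * ((L : ℝ) ^ 2 * α₀)) * (1 + D * ((L : ℝ) * α₂)) :=
        mul_le_mul (Real.exp_le_exp.2 (mul_le_mul_of_nonneg_left h1 hc)) (by linarith) h4 (Real.exp_pos _).le
    _ ≤ 2 := h

/-- `2α₂ ≤ c₃` from `2(Lα₂) ≤ c₃` (`L ≥ 1`, `α₂ ≥ 0`). [cite: Balaban1985Averaging, (100) p.32] (arithmetic) -/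
theorem hc₃P_of_γ {L : ℕ} (hL : 1 ≤ L) {α₂ : ℝ} (hα₂ : 0 ≤ α₂) (h : 2 * ((L : ℝ) * α₂) ≤ c3 d L) : 2 * α₂ ≤ c3 d L := by
  have hLr : (1 : ℝ) ≤ L := by exact_mod_cast hL
  have h2 : α₂ ≤ (L : ℝ) * α₂ := le_mul_of_one_le_left hα₂ hLr
  linarith

/-- The collar window in the datum letter: `4·B_∂·a ≤ (dL − 1)·B₀·(α₀ + α₁)` from `4·B_∂ ≤ (dL − 1)·B₀` and `0 ≤ a ≤ α₁`, `0 ≤ α₀` (`1 ≤ dL`, `0 ≤ B₀`).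
[cite: Balaban1985RegularSpaces, (1.66) p.87, Thm 4 p.88] (arithmetic) -/
theorem hbdry_of_hBd {L : ℕ} (hdL : 1 ≤ d * L) {Bbd B₀ a α₀ α₁ : ℝ} (hB₀ : 0 ≤ B₀) (ha0 : 0 ≤ a) (ha : a ≤ α₁) (hα₀ : 0 ≤ α₀)
    (hBd : 4 * Bbd ≤ ((d : ℝ) * L - 1) * B₀) : 4 * Bbd * a ≤ ((d : ℝ) * L - 1) * B₀ * (α₀ + α₁) := by
  have hdL' : (1 : ℝ) ≤ (d : ℝ) * L := by exact_mod_cast hdL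
  have h0 : 0 ≤ ((d : ℝ) * L - 1) * B₀ := mul_nonneg (by linarith) hB₀
  calc 4 * Bbd * a ≤ ((d : ℝ) * L - 1) * B₀ * a := mul_le_mul_of_nonneg_right hBd ha0
    _ ≤ ((d : ℝ) * L - 1) * B₀ * (α₀ + α₁) := mul_le_mul_of_nonneg_left (by linarith) h0

/-! ## §3 Theorem 4's (1.66)₀ row on the sides touching `□₀` from J3's fine row on `□̃` -/

/-- ★ **(1.66)₀ ON THE SIDES TOUCHING `□₀` FROM THE FINE ROW ON THE TILDE-CUBE** (`L ≥ 2`, `ρ ≥ 1`): every bond that is a side of a plaquette touching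
`□₀ = cubeFam false L a M ρ k 0` lies in `□̃ = [tlo (tLo a ρ) k, thi (tHi a M ρ) k]` (lit ✓`collar_cube` + ✓`ends_of_sideTouches`), where J3's row (d) at depth `k` bounds
`‖U′ − 1‖`. [cite: Balaban1985RegularSpaces, (1.66) p.87, p.98 («□̃»), p.77 (convention before (1.5))] -/
theorem h66_of_fine {𝔸 : Type*} [CStarAlgebra 𝔸] {L : ℕ} (hL : 2 ≤ L) (a : Site d) (M : ℕ) {ρ : ℕ} (hρ : 1 ≤ ρ) (k : ℕ)
    {U' : Site d → Fin d → 𝔸ˣ} {s : ℝ}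
    (hfine : ∀ (x : Site d) (ν : Fin d), tlo L (tLo a ρ) k ≤ x → x + e ν ≤ thi L (tHi a M ρ) k → ‖((U' x ν : 𝔸ˣ) : 𝔸) - 1‖ < s) :
    ∀ b ∈ {b : Site d × Fin d | SideTouches (cubeFam false L a M ρ k 0) b.1 b.2}, ‖((U' b.1 b.2 : 𝔸ˣ) : 𝔸) - 1‖ ≤ s := by
  intro b hb
  have hb' : SideTouches (cube L a M ρ k 0) b.1 b.2 := by
    have h := hb
    rw [Set.mem_setOf_eq, cubeFam_false_of_le L a M ρ (Nat.zero_le k)] at h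
    exact h
  obtain ⟨h1, h2⟩ := ends_of_sideTouches (collar_cube hL hρ (Nat.zero_le k)) hb'
  exact (hfine b.1 b.2 h1 h2).le

end Summit.QuantumFields.YangMills.Theorems.HalvingHGammaComposerJoins

end
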